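import Literature.NumberTheory.LFunctions.KMVMomentsToHalfEdge
import Literature.NumberTheory.LFunctions.KMVHeckeRecursionExactAFE
import Literature.NumberTheory.LFunctions.KMVCutoffWAfeWBridge
import Literature.NumberTheory.LFunctions.KMVFirstMomentBeyondDiagonal
import HarnessLib

/-!
# Route `PrimeLevelFamEdge`, crux K_B (stmt-Parity-20343), line `diagonal_kernel_split`, helper H4
# (exact Petersson/AFE split of the mollified second moment), part (a): EXPANSION
# `Q^h(P, 1; M) = Σ_{l,m ≤ M} x_l x_m · T_q(l,m)`, `T_q(l,m) = Σ^h_f Λ(f,½)² λ_f(l) λ_f(m)`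

STUB-PLAN §5 H4 («k=1 S1 split: `Q^h − 2q̂K = 2q̂·CORNER + re OFF` exactly … ls-inputs types H-AFE/H-Hecke
first, then prover»). The inputs are now theorems of the tree (H-AFE `KMV2000.completedL_half_sq_eq_holds`,
H-Hecke `heckeLambda_mul_heckeLambda_primeLevel`, Petersson `kowalskiMichel2000_peterssonFormula_holds`), so
the exact split is prover work; it is done in three helper files: (a) this one — the mollified second moment
at `Q = 1` is the quadratic form of the TWISTED harmonic second moment `twistedSecond q l m` in the real
mollifier coefficients `KMV2000.mollifierCoeff P M m = μ(m)ψ(m)⁻¹m^{−1/2}P(log(M/m)/log M)` (reality of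
`Λ(f,½)` and of `λ_f` on newforms: `kmv2000_p4_real_holds`); (b) AFE ⊗ Hecke ⊗ Petersson for
`twistedSecond` (`= 2q̂ Σ_{n₁,n₂} (n₁n₂)^{−1/2} W(n₁n₂/q̂²) Σ_{d₁∣(l,n₁)} Σ_{d₂∣(m,n₂)} Δ_q(ln₁/d₁², mn₂/d₂²)`,
`l, m < q`); (c) `Δ_q = δ − J_q` and the diagonal resummation to `2q̂·Corner.trueDiagKernel(q̂)`.
Nothing here bounds anything; (a) is an identity. Helper; closes nothing; standard axioms.
«The programme SEARCHES and TYPES; no claim about Landau–Siegel zeros, Theorems 1–2 of arXiv:2211.02515 or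
a repaired Margin232 until a kernel theorem says so.»
-/

noncomputable section

open Finset Polynomial CongruenceSubgroup
open scoped Real

namespace Summit.Parity.GeneralizedHardyLittlewood.Theorems.BeyondDiagonalBeatsQuarter.PeterssonSplit

open Literature.NumberTheory.LFunctions Literature.NumberTheory.LFunctions.KMV2000
open Literature.NumberTheory.EllipticCurves.ModularForms
open Literature.NumberTheory.LFunctions.CentralValueFamilyHalfEdge (heckeLambda_eq_ofReal_re)

variable {q : ℕ} [NeZero q]

/-- **The twisted harmonic second moment of the completed central value** at prime level `q`:
`T_q(l, m) := Σ^h_{f ∈ S₂(q)^*} Λ(f, ½)² λ_f(l) λ_f(m)` (harmonic weights `ω_f = 1/(4π(f,f))`,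
`Λ = KMV2000.completedL`, `λ_f = GL2Family.heckeLambda`). A bookkeeping abbreviation of this line
(no new mathematics). [cite: KowalskiMichelVanderKam2000, §6 p. 19 (Q^h(P,Q)) with (21) p. 12 — derivation] -/
def twistedSecond (q : ℕ) [NeZero q] (l m : ℕ) : ℂ :=
  GL2Family.harmonicSum q 2 (fun f ↦ completedL q f (1 / 2) ^ 2 *
    (GL2Family.heckeLambda f l * GL2Family.heckeLambda f m))

/-- On a newform of prime level the completed central value `Λ(f, ½)` is REAL (KMV p. 4; tree
`kmv2000_p4_real_holds` with `derivLambda_zero`). [cite: KowalskiMichelVanderKam2000, p. 4] -/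
theorem completedL_half_eq_ofReal (hq : q.Prime) {f : CuspForm (Gamma0 q) 2} (hf : f ∈ newforms0 q 2) :
    completedL q f (1 / 2) = (((completedL q f (1 / 2)).re : ℝ) : ℂ) := by
  have h := (kmv2000_p4_real_holds q hq f hf).2 0
  rw [derivLambda_zero] at h
  exact Complex.ext (by rw [Complex.ofReal_re]) (by rw [Complex.ofReal_im]; exact h)

/-- `T_q(l,m)` as a finite REAL weighted sum over the newforms:
`T_q(l,m) = Σ_f ω_f (re Λ(f,½))² re λ_f(l) re λ_f(m)`. [cite: IwaniecKowalski2004, (14.60) — derivation] -/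
theorem twistedSecond_eq_sum (hq : q.Prime) (l m : ℕ) :
    twistedSecond q l m = ((∑ f ∈ (finite_newforms0_holds q 2).toFinset,
      IwaniecSarnak.harmonicWeight f * ((completedL q f (1 / 2)).re ^ 2 *
        ((GL2Family.heckeLambda f l).re * (GL2Family.heckeLambda f m).re)) : ℝ) : ℂ) := by
  unfold twistedSecond GL2Family.harmonicSum
  rw [finsum_mem_eq_finite_toFinset_sum _ (finite_newforms0_holds q 2)]
  push_cast
  refine Finset.sum_congr rfl fun f hf ↦ ?_
  have hf' : f ∈ newforms0 q 2 := (Set.Finite.mem_toFinset _).1 hf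
  have hN : IsNewform0 f := hf'
  rw [KowalskiMichel2000.harmonicWeight_eq, completedL_half_eq_ofReal hq hf',
    heckeLambda_eq_ofReal_re hN l, heckeLambda_eq_ofReal_re hN m]
  simp only [Complex.ofReal_re]

/-- **H4 (a): expansion of the mollified second moment at `Q = 1`.** For `q` prime,
`Q^h(P, 1; M) = Σ_{l,m ≤ M} x_l x_m · T_q(l,m)` with the REAL mollifier coefficients
`x_m = μ(m)ψ(m)⁻¹m^{−1/2}P(log(M/m)/log M)` (`KMV2000.mollifierCoeff`) and the twisted harmonic second
moment `T_q(l,m) = Σ^h Λ(f,½)² λ_f(l)λ_f(m)` (`twistedSecond`): `|Λ M_P|² = Λ² M_P²` since `Λ(f,½)` and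
`λ_f` are real on newforms. [cite: KowalskiMichelVanderKam2000, §6 p. 19 and (9) p. 7 — derivation] -/
theorem QhPQ_one_eq_sum_twistedSecond (hq : q.Prime) (P : ℝ[X]) (M : ℝ) :
    QhPQ q P 1 M = ∑ l ∈ Icc 1 ⌊M⌋₊, ∑ m ∈ Icc 1 ⌊M⌋₊,
      ((mollifierCoeff P M l * mollifierCoeff P M m : ℝ) : ℂ) * twistedSecond q l m := by
  -- right side: each `T_q(l,m)` as a real sum; everything is real
  have hT : ∀ l m : ℕ, ((mollifierCoeff P M l * mollifierCoeff P M m : ℝ) : ℂ) * twistedSecond q l m =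
      ((∑ f ∈ (finite_newforms0_holds q 2).toFinset,
        IwaniecSarnak.harmonicWeight f * ((completedL q f (1 / 2)).re ^ 2 *
          (mollifierCoeff P M l * (GL2Family.heckeLambda f l).re *
            (mollifierCoeff P M m * (GL2Family.heckeLambda f m).re))) : ℝ) : ℂ) := by
    intro l m
    rw [twistedSecond_eq_sum hq, ← Complex.ofReal_mul, Finset.mul_sum]
    congr 1
    exact Finset.sum_congr rfl fun f _ ↦ by ring
  -- left side: each `ω_f |Λ M_P|²` expanded
  have hL : ∀ f ∈ (finite_newforms0_holds q 2).toFinset,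
      IwaniecSarnak.harmonicWeight f * ‖completedL q f (1 / 2) * mollifierP q P M f‖ ^ 2 =
        ∑ l ∈ Icc 1 ⌊M⌋₊, ∑ m ∈ Icc 1 ⌊M⌋₊,
          IwaniecSarnak.harmonicWeight f * ((completedL q f (1 / 2)).re ^ 2 *
            (mollifierCoeff P M l * (GL2Family.heckeLambda f l).re *
              (mollifierCoeff P M m * (GL2Family.heckeLambda f m).re))) := by
    intro f hf
    have hf' : f ∈ newforms0 q 2 := (Set.Finite.mem_toFinset _).1 hf
    rw [completedL_half_eq_ofReal hq hf', mollifierP_eq_ofReal hf' P M, ← Complex.ofReal_mul,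
      Complex.norm_real, Real.norm_eq_abs, sq_abs, mul_pow, sq (∑ m ∈ Icc 1 ⌊M⌋₊, _),
      Finset.sum_mul_sum, Finset.mul_sum, Finset.mul_sum]
    refine Finset.sum_congr rfl fun l _ ↦ ?_
    rw [Finset.mul_sum, Finset.mul_sum]
    refine Finset.sum_congr rfl fun m _ ↦ ?_
    simp only [mollifierCoeff, Complex.ofReal_re]
    ring
  rw [QhPQ_one_eq_sum, Finset.sum_congr rfl hL]
  simp_rw [hT]
  push_cast
  rw [Finset.sum_comm]
  refine Finset.sum_congr rfl fun l _ ↦ ?_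
  rw [Finset.sum_comm]

end Summit.Parity.GeneralizedHardyLittlewood.Theorems.BeyondDiagonalBeatsQuarter.PeterssonSplit
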